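import Literature.IUT.LogThetaLattice.PacketLogVolumesHaarModelNormalization
import Literature.IUT.LogThetaLattice.PacketWeights
import Mathlib.NumberTheory.NumberField.InfinitePlace.TotallyRealComplex
import HarnessLib

/-!
# [IUTchIII] Remark 3.1.1 (ii) / Proposition 3.9 (i), (iii): the archimedean packet-normalisation factor is
# FORCED — with the LITERAL archimedean weights `1/[F_mod:ℚ]` (no factor `[K_{v̲}:ℝ]`) the global log-volume moves
# by `−r₂·log p/[F:ℚ]` under `p ∈ F_mod^×`, so it is `F_mod^×`-invariant iff `F_mod` is totally real
# (abc-iut cell, layer L6; rows CAP39/REL39, split-off «N1-LITERAL-WEIGHTS»; proof-only)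

S. Mochizuki, *Inter-universal Teichmüller theory III*, kurims manuscript (May 2020), §3 [claim: Mochizuki2012,
status: disputed]. Remark 3.1.1 (ii), p. 94: the summand of `log(^α𝓕_{v_ℚ})` at `v` carries "the normalized weight
`1/([K_v : (F_mod)_v]·(Σ_{𝕍_mod ∋ w | v_ℚ} [(F_mod)_w : ℚ_{v_ℚ}]))` … normalized so that multiplication by
`p_{v_ℚ}` affects log-volumes by addition or subtraction … of the quantity `log(p_{v_ℚ})`". Proposition 3.9 (i),
p. 116 (archimedean `v_ℚ`): "the sum of the radial log-volumes on each of the direct summand complex archimedean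
fields … — cf. … the discussion of normalized weights in Remark 3.1.1, (ii), (iii), (iv) — determines [cf.
[AbsTopIII], Proposition 5.7, (ii)] log-volumes … normalized so that multiplication … by `e = 2.71828...`
corresponds to adding the quantity `1 = log(e) ∈ ℝ`; we shall refer to this normalization as the
packet-normalization." (iii), p. 117: "`μ^log_{A,𝕍_ℚ}` … invariant with respect to multiplication by elements of
`(†𝕄⊛_mod)_α`". [AbsTopIII] Prop. 5.7 (ii)(b), p. 138: the radial log-volume is a LENGTH, `μ^log(x·A) =
μ^log(A) + log|x|`.

THE POINT (second-reader note N1 of abc-iut-w5-d211 on p421193/p421634, 2026-08-26, made kernel here). At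
`v_ℚ = ∞` the two printed sentences pull apart: with the radial volume (a length: `×e ↦ +1` PER complex summand)
and the LITERAL weight of Remark 3.1.1 (ii) at `K = F_mod = F`, namely `1/Σ_{w|∞}[F_w:ℝ] = 1/[F:ℚ]` at EVERY
archimedean `w` (abc-iut-L6-t4's verbatim `packetWeight` at `degKF = 1`, see `literalArchWeight_eq_packetWeight`),
the archimedean packet moves under `×e` by `(r₁+r₂)/[F:ℚ]` — `= 1/2`, not `1`, for the totally complex `F ∋ √−1`
of [IUTchI] Def. 3.1 (b). The tree's genuine models (abc-iut-L6-d3 `haarWeight F (inl w) = [F_w:ℝ]/[F:ℚ]`,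
p415871; relative: abc-iut-L6-t5 / abc-iut-w5-d030 `relHaarWeight`) therefore read "normalized so that `×e ↦ +1`" as a
RESCALING by the packet-normalisation factor `[F_w:ℝ]` (docstrings say so; kernel: `sum_haarWeight_arch`,
`packetLogModulus_infty_natCast : ×p ↦ +log p` at `∞`). THIS FILE proves that the rescaling is FORCED by
Prop. 3.9 (iii) itself: with the literal weights the global log-volume is NOT invariant under `F_mod^×` unless
`F_mod` is totally real.
* `literalArchChange_natCast_prime`: for a rational prime `p`, viewed in `F^×`, the literal archimedean change is
  `Σ_{w|∞} (1/[F:ℚ])·log|p|_w = (r₁+r₂)·log p/[F:ℚ]` (`|p|_w = p` at every `w`);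
* `literalFiniteChange_natCast_prime`: at the packet over `p` the literal weight IS the tree's (`1/[F:ℚ]`, no factor
  is in question at finite places: [AbsTopIII] Prop. 5.7 (i)'s `p`-adic log-volume is Haar, `×p ↦ −[F_v:ℚ_p]·log p`
  per summand) and the change is `Σ_{v|p}(1/[F:ℚ])·log‖p‖_v = −log p` (d3's `packetLogModulus_prime_self`); at
  the packets over `ℓ ≠ p` nothing moves (d3's `packetLogModulus_prime_of_ne`, cited, not restated);
* **`literalGlobalChange_natCast_prime`**: hence the literal GLOBAL change under `p` is `−r₂·log p/[F:ℚ]`,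
  `r₂ = #{complex places}` (Mathlib `card_eq_nrRealPlaces_add_nrComplexPlaces`, `card_add_two_mul_card_eq_rank`);
* **`literalGlobalChange_eq_zero_iff`**: `= 0 ⟺ F` totally real (Mathlib `nrComplexPlaces_eq_zero_iff`) — so for
  every `F` with a complex place NO global log-volume assembled with the literal archimedean weights can satisfy
  Prop. 3.9 (iii)'s invariance clause (it already fails at `f = 2`);
* **`literalGlobalChange_totallyComplex`**: for totally complex `F` (the IUT case) the defect is exactly
  `−(log p)/2` (N1's "net `−(log 2)/2`"; Mathlib `IsTotallyComplex.finrank : [F:ℚ] = 2r₂`);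
* contrast `treeGlobalChange_natCast_prime`: with the tree's weights the same global change is `+log p − log p = 0`
  (d3's `packetLogModulus_infty_natCast` + `packetLogModulus_prime_self`), as the product formula demands.

HONEST SCOPE. This is bookkeeping about which reading of two printed normalisation sentences is consistent; it
records that the tree's (labelled) packet-normalisation factor is the unique product-formula-compatible one, and
asserts nothing about [IUTchIII] Cor. 3.12 or about which reading the author intends beyond the quoted words; no
side taken; typed ≠ endorsed. Classical (`|p|_w = p`, `Σ_{v|p} e_v f_v = [F:ℚ]`, `r₁ + 2r₂ = [F:ℚ]`). Proof-only,
no definitions: the literal weight is written `1/[F:ℚ]` and identified BY NAME with t4's `packetWeight`.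
-/

noncomputable section

namespace Literature.IUT.LogThetaLattice

open Literature.IUT.LogVolume NumberField NumberField.InfinitePlace IsDedekindDomain

variable (F : Type) [Field F] [NumberField F]

/-! ### The literal archimedean weight of Remark 3.1.1 (ii) at `K = F_mod`: `1/Σ_{w|∞}[F_w:ℝ] = 1/[F:ℚ]` -/

/-- **The literal archimedean weight IS abc-iut-L6-t4's verbatim `packetWeight` at `K = F_mod`**:
`packetWeight([F_·:ℝ], 1)(w) = 1/(1·Σ_{w'|∞}[F_{w'}:ℝ]) = 1/[F:ℚ]` for every archimedean `w` (Mathlib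
`InfinitePlace.sum_mult_eq`) — no factor `[F_w:ℝ]`; compare d3's `haarWeight F (inl w) = [F_w:ℝ]/[F:ℚ]`.
[claim: Mochizuki2012, status: disputed] -/
theorem literalArchWeight_eq_packetWeight (w : InfinitePlace F) :
    packetWeight (fun w' : InfinitePlace F => (⟨w'.mult, InfinitePlace.mult_pos⟩ : ℕ+)) (fun _ => 1) w =
      1 / (Module.finrank ℚ F : ℝ) := by
  have hsum : (∑ w' : InfinitePlace F, (w'.mult : ℝ)) = Module.finrank ℚ F := by
    exact_mod_cast InfinitePlace.sum_mult_eq (K := F)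
  simp only [packetWeight, PNat.mk_coe, PNat.one_coe, Nat.cast_one, one_mul, hsum]

/-- d3's archimedean weight is the literal one TIMES the packet-normalisation factor `[F_w:ℝ] ∈ {1,2}`:
`haarWeight F (inl w) = [F_w:ℝ] · (1/[F:ℚ])`. [claim: Mochizuki2012, status: disputed] -/
theorem haarWeight_inl_eq_mult_mul_literal (w : InfinitePlace F) :
    haarWeight F (Sum.inl w) = (w.mult : ℝ) * (1 / (Module.finrank ℚ F : ℝ)) := by
  rw [haarWeight_inl, mul_one_div]

/-! ### `|p|_w = p` and the place counts -/

omit [NumberField F] in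
/-- `|n|_w = n` at every archimedean place (`‖σ_w(n)‖ = n`). [folklore] -/
private theorem infinitePlace_apply_natCast (w : InfinitePlace F) (n : ℕ) : w (n : F) = n := by
  rw [← InfinitePlace.norm_embedding_eq, map_natCast, Complex.norm_natCast]

/-- `(r₁ + r₂) + r₂ = [F:ℚ]`: the number of archimedean places plus the number of complex ones is the degree
(Mathlib `card_eq_nrRealPlaces_add_nrComplexPlaces`, `card_add_two_mul_card_eq_rank`). [folklore] -/
private theorem card_infinitePlace_add_nrComplexPlaces :
    Fintype.card (InfinitePlace F) + nrComplexPlaces F = Module.finrank ℚ F := by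
  rw [card_eq_nrRealPlaces_add_nrComplexPlaces, ← card_add_two_mul_card_eq_rank]
  ring

/-- The same in `ℝ`. [folklore] -/
private theorem card_infinitePlace_add_nrComplexPlaces_real :
    (Fintype.card (InfinitePlace F) : ℝ) + nrComplexPlaces F = Module.finrank ℚ F := by
  exact_mod_cast card_infinitePlace_add_nrComplexPlaces F

/-! ### The literal changes under a rational prime `p ∈ F^×` -/

/-- **Literal archimedean change**: `Σ_{w|∞} (1/[F:ℚ])·log|p|_w = (r₁+r₂)·log p/[F:ℚ]` — each of the `r₁ + r₂`
archimedean summands moves by `log p` ([AbsTopIII] Prop. 5.7 (ii)(b): the radial log-volume is a length) and is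
weighted literally by `1/[F:ℚ]`. [claim: Mochizuki2012, status: disputed] -/
theorem literalArchChange_natCast_prime (p : Nat.Primes) :
    ∑ w : InfinitePlace F, 1 / (Module.finrank ℚ F : ℝ) * Real.log (w ((p : ℕ) : F)) =
      (Fintype.card (InfinitePlace F) : ℝ) * Real.log p / Module.finrank ℚ F := by
  simp only [infinitePlace_apply_natCast, Finset.sum_const, Finset.card_univ, nsmul_eq_mul]
  ring

/-- With the tree's factor the archimedean change is `+log p` (d3's `packetLogModulus_infty_natCast`); the literal
change falls short of it by exactly `r₂·log p/[F:ℚ]`. [claim: Mochizuki2012, status: disputed] -/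
theorem literalArchChange_eq_packetLogModulus_sub (p : Nat.Primes) :
    ∑ w : InfinitePlace F, 1 / (Module.finrank ℚ F : ℝ) * Real.log (w ((p : ℕ) : F)) =
      packetLogModulus F (Units.mk0 ((p : ℕ) : F) (by exact_mod_cast p.2.ne_zero)) RatPlace.infty -
        (nrComplexPlaces F : ℝ) * Real.log p / Module.finrank ℚ F := by
  rw [literalArchChange_natCast_prime, packetLogModulus_infty_natCast,
    ← card_infinitePlace_add_nrComplexPlaces_real]
  have hpos : (Fintype.card (InfinitePlace F) : ℝ) + nrComplexPlaces F ≠ 0 := by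
    rw [card_infinitePlace_add_nrComplexPlaces_real]
    exact (FinDivisor.finrank_pos (F := F)).ne'
  field_simp
  ring

/-- **Literal finite change at the packet over `p`**: `Σ_{v|p} (1/[F:ℚ])·log‖p‖_v = −log p` — here the literal
weight `1/([F_v:F_v]·Σ_{w|p}[F_w:ℚ_p]) = 1/[F:ℚ]` IS the tree's `haarWeight F (inr v)` (no factor is in question at
a finite place), and this is d3's `packetLogModulus_prime_self` unfolded (`log‖p‖_v = −e_v f_v·log p`,
`Σ_{v|p} e_v f_v = [F:ℚ]`). [claim: Mochizuki2012, status: disputed] -/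
theorem literalFiniteChange_natCast_prime (p : Nat.Primes) :
    ∑ v ∈ placesOver F (p : ℕ), 1 / (Module.finrank ℚ F : ℝ) *
        Real.log (NumberField.HeightOneSpectrum.adicAbv F v ((p : ℕ) : F)) = -Real.log p := by
  haveI : Fact (p : ℕ).Prime := ⟨p.2⟩
  have h := packetLogModulus_prime_self F p
  have hg := sum_packet_prime F p
    (fun v => haarWeight F v * Real.log ((placeDatum F v).modulus ((p : ℕ) : F)))
  simp only [packetLogModulus, Units.val_mk0] at h hg
  rw [hg] at h
  simpa only [placeDatum_inr, nonarchDatum_modulus, haarWeight_inr] using h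

/-- **The literal GLOBAL change under `p ∈ F^×` is `−r₂·log p/[F:ℚ]`**: archimedean packet `(r₁+r₂)·log p/[F:ℚ]`
(literal) plus the packet over `p` (`−log p`); every other packet is fixed (`‖p‖_v = 1` for `v ∤ p`, d3's
`packetLogModulus_prime_of_ne`). [claim: Mochizuki2012, status: disputed] -/
theorem literalGlobalChange_natCast_prime (p : Nat.Primes) :
    (∑ w : InfinitePlace F, 1 / (Module.finrank ℚ F : ℝ) * Real.log (w ((p : ℕ) : F))) +
        packetLogModulus F (Units.mk0 ((p : ℕ) : F) (by exact_mod_cast p.2.ne_zero)) (RatPlace.prime p) =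
      -((nrComplexPlaces F : ℝ) * Real.log p / Module.finrank ℚ F) := by
  rw [literalArchChange_eq_packetLogModulus_sub, packetLogModulus_infty_natCast, packetLogModulus_prime_self]
  ring

/-- **Contrast: with the tree's packet-normalised weights the global change under `p` is `0`**
(`+log p` at `∞`, `−log p` at `p`): the product formula, as Prop. 3.9 (iii) requires.
[claim: Mochizuki2012, status: disputed] -/
theorem treeGlobalChange_natCast_prime (p : Nat.Primes) :
    packetLogModulus F (Units.mk0 ((p : ℕ) : F) (by exact_mod_cast p.2.ne_zero)) RatPlace.infty +
        packetLogModulus F (Units.mk0 ((p : ℕ) : F) (by exact_mod_cast p.2.ne_zero)) (RatPlace.prime p) = 0 := by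
  rw [packetLogModulus_infty_natCast, packetLogModulus_prime_self, add_neg_cancel]

/-! ### The verdict: invariance with literal weights ⟺ `F` totally real; the IUT case -/

/-- **The literal global change under `p` vanishes iff `F` is totally real** (`r₂ = 0`, Mathlib
`nrComplexPlaces_eq_zero_iff`): for every number field with a complex place, a global log-volume assembled with
Remark 3.1.1 (ii)'s LITERAL archimedean weights violates Prop. 3.9 (iii)'s invariance clause already at `f = p`.
[claim: Mochizuki2012, status: disputed] -/
theorem literalGlobalChange_eq_zero_iff (p : Nat.Primes) :
    (∑ w : InfinitePlace F, 1 / (Module.finrank ℚ F : ℝ) * Real.log (w ((p : ℕ) : F))) +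
        packetLogModulus F (Units.mk0 ((p : ℕ) : F) (by exact_mod_cast p.2.ne_zero)) (RatPlace.prime p) = 0 ↔
      IsTotallyReal F := by
  rw [literalGlobalChange_natCast_prime, neg_eq_zero, ← nrComplexPlaces_eq_zero_iff]
  have hd : (0 : ℝ) < Module.finrank ℚ F := FinDivisor.finrank_pos (F := F)
  have hlog : 0 < Real.log p := Real.log_pos (by exact_mod_cast p.2.one_lt)
  constructor
  · intro h
    have h' : (nrComplexPlaces F : ℝ) * Real.log p = 0 := by
      rcases (div_eq_zero_iff.mp h) with h | h
      · exact h
      · exact absurd h hd.ne'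
    rcases mul_eq_zero.mp h' with h | h
    · exact_mod_cast h
    · exact absurd h hlog.ne'
  · intro h
    rw [h, Nat.cast_zero, zero_mul, zero_div]

/-- Equivalently: a complex place makes the literal global change NONZERO. [claim: Mochizuki2012, status: disputed] -/
theorem literalGlobalChange_ne_zero (hF : ¬ IsTotallyReal F) (p : Nat.Primes) :
    (∑ w : InfinitePlace F, 1 / (Module.finrank ℚ F : ℝ) * Real.log (w ((p : ℕ) : F))) +
        packetLogModulus F (Units.mk0 ((p : ℕ) : F) (by exact_mod_cast p.2.ne_zero)) (RatPlace.prime p) ≠ 0 :=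
  fun h => hF ((literalGlobalChange_eq_zero_iff F p).mp h)

/-- **The IUT case** (`F ∋ √−1` totally complex, [IUTchI] Def. 3.1 (b)): the literal global change under `p` is
exactly `−(log p)/2` — abc-iut-w5-d211's "net `−(log 2)/2`" at `p = 2` — since `[F:ℚ] = 2r₂` (Mathlib
`IsTotallyComplex.finrank`). The archimedean packet moves by `(r₂/[F:ℚ])·log p = (log p)/2` instead of the
packet-normalised `log p`: print's "`×e ↦ +1`" is the rescaled reading. [claim: Mochizuki2012, status: disputed] -/
theorem literalGlobalChange_totallyComplex [IsTotallyComplex F] (p : Nat.Primes) :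
    (∑ w : InfinitePlace F, 1 / (Module.finrank ℚ F : ℝ) * Real.log (w ((p : ℕ) : F))) +
        packetLogModulus F (Units.mk0 ((p : ℕ) : F) (by exact_mod_cast p.2.ne_zero)) (RatPlace.prime p) =
      -(Real.log p / 2) := by
  rw [literalGlobalChange_natCast_prime, NumberField.IsTotallyComplex.finrank]
  have hd : (0 : ℝ) < Module.finrank ℚ F := FinDivisor.finrank_pos (F := F)
  rw [NumberField.IsTotallyComplex.finrank] at hd
  have hr : (nrComplexPlaces F : ℝ) ≠ 0 := by
    intro h
    rw [Nat.cast_mul, h, mul_zero] at hd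
    exact lt_irrefl _ hd
  push_cast
  field_simp

/-- The IUT case, archimedean packet alone: literal change `(log p)/2` versus the packet-normalised `log p`.
[claim: Mochizuki2012, status: disputed] -/
theorem literalArchChange_totallyComplex [IsTotallyComplex F] (p : Nat.Primes) :
    ∑ w : InfinitePlace F, 1 / (Module.finrank ℚ F : ℝ) * Real.log (w ((p : ℕ) : F)) = Real.log p / 2 := by
  have h := literalGlobalChange_totallyComplex F p
  rw [packetLogModulus_prime_self] at h
  linarith

end Literature.IUT.LogThetaLattice

end
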